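import Summits.ABC.ABC.Theses.RootDecompB
import HarnessLib

/-!
# Route RootDecompB — split glue `KummerFloor5Glue` (item stmt-ABC-25301)

`KummerFloorLow → KummerFloorHigh → KummerFloor5` (`Summit.ABC.ABC.Theses.RootDecompB.KummerFloor5Glue`):
the level-5 floor `c ≤ C·N₅(abc)⁴` on the generic Kummer stratum (at most one perfect-fifth-power
coordinate) and on the degree-5 stratum (at least two) reassemble the floor on all abc triples with
`C := max C_L C_H` and a case split on the stratum (lens-6 gen-2 KummerDegreeSplit, kernel
`kummerFloor5_of_children`; cell decomp-abc writer LANDING LIST, door B).  Bookkeeping only (size S);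
proves neither `ABC` nor any crux.
-/

set_option linter.dupNamespace false

namespace Summit.ABC.ABC.Theorems

/-- Item stmt-ABC-25301, literally the route decl `RootDecompB.KummerFloor5Glue`. -/
theorem rootDecompB_kummerFloor5Glue_proof : Summit.ABC.ABC.Theses.RootDecompB.KummerFloor5Glue := by
  unfold Summit.ABC.ABC.Theses.RootDecompB.KummerFloor5Glue
    Summit.ABC.ABC.Theses.RootDecompB.KummerFloorLow Summit.ABC.ABC.Theses.RootDecompB.KummerFloorHigh
    Summit.ABC.ABC.Theses.RootDecompB.KummerFloor5
  rintro ⟨CL, hL⟩ ⟨CH, hH⟩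
  refine ⟨max CL CH, fun a b c ht => ?_⟩
  by_cases h : (∃ x y : ℕ, a = x ^ 5 ∧ b = y ^ 5) ∨ (∃ x z : ℕ, a = x ^ 5 ∧ c = z ^ 5) ∨
      (∃ y z : ℕ, b = y ^ 5 ∧ c = z ^ 5)
  · exact (hH a b c ht h).trans (Nat.mul_le_mul_right _ (le_max_right _ _))
  · exact (hL a b c ht h).trans (Nat.mul_le_mul_right _ (le_max_left _ _))

end Summit.ABC.ABC.Theorems
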